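import Summits.HodgeConjecture.CorCM.DecicCurveFivefoldHodgeOfMarkman
import Summits.HodgeConjecture.CorCM.DecicCurveFivefoldCyclicFrame
import HarnessLib

/-!
# COR-CM — the Hodge conjecture for `B₀^a × E^c` (Galois decic CM field, half-circle type) modulo Markman's sixfold
# theorem: the INTRINSIC form (no frame and no `Aut(ℂ)` data in the statement)

Cell `pub-hodgecm2` (COR-CM), seat b09 gen 18 (2026-08-21); count-neutral own lane DECIC-EB0 = lit-andre-3's prover-lane ask
A6-R22 «`CorCM/` THEOREM HC(E^a × B₀^b) for cyclic decic F on the real carriers» (PORTFOLIO-lit-andre-3-g10 §0 (5a), §6);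
theorems only, no definition, no named fact, no `sorry`.  HONEST FRAMING: CONDITIONAL on the single displayed named fact
`HodgeTheory.Markman2025_weilClasses_algebraic_hyperbolicSixfold` (E. Markman, arXiv:2502.03415 Thm 1.5.1, UNREFEREED);
`HC_CM` is not asserted and no case of the Hodge conjecture is claimed unconditionally.

`CorCM/DecicCurveFivefoldHodgeOfMarkman.lean` proves the result in FRAME FORM; `CorCM/DecicCurveFivefoldCyclicFrame.lean`
constructs the frame (`exists_cyclicFrame`) for every Galois CM field of degree `10`.  Here:

* **`hodgeConjectureFor_biproduct_comp_vec_of_halfCircle_of_markmanSixfold`** — `F` a Galois CM field with `[F:ℚ] = 10`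
  (its group is then cyclic, `exists_generator_ten`), `σ` ANY generator of `Gal(F/ℚ)`, `k` imaginary quadratic with
  `i : k → F`, `δ ∈ 𝓞_k`, `δ² = -d`, `τ(δ) = i√d`, `p : F → ℂ` with `p|_k = τ̄`, `B ⊨ (F; Φ)` with `Φ = {p ∘ σⁿ : n < 5}` — the
  HALF-CIRCLE type (lit-andre-3's `{0,1,2,3,4}`; its `Aut`-twists, e.g. `{0,1,3,4,7}`, are half-circles for other generators)
  —, `E ⊨ (k; {τ})`: for every slot map `κ : Fin N → Fin 2`, every rational `(q,q)`-class on `⨁_j ![B, E] (κ j)` — i.e. on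
  `B^a × E^c`, all `a, c`, any order — is algebraic, GIVEN ONLY Markman's sixfold theorem;
* the dominated / isogenous-product / all-powers forms, and the literal sixfold `B × E`
  (`hodgeConjectureFor_prod_of_halfCircle_of_markmanSixfold`).
WHAT IS NEW (lit-andre-3 PORTFOLIO-g10 §0 (5a), «modulo Markman»): e.g. for the decic subfield `K₃₁ ⊂ ℚ(ζ₃₁)` and `E` with CM
by `ℚ(√-31)` — CM sixfolds `B₀ × E` on which only divisor classes were known — and all `B₀^a × E^c`; for `ℚ(ζ₁₁)` the
conclusion is already unconditional by Shioda–Aoki (all types Fermat), so nothing new is claimed there.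
[cite: Markman2025SecantWeil, Thm 1.5.1] [cite: Pohlmann1968, Thm 1] [cite: Deligne1982HodgeCycles, §4 Prop. 4.4, §5 (c)]
[cite: MoonenZarhin1999LowDim, Thm. 0.1 (a)] [cite: Shimura1998, §8.4] [cite: MumfordAV1970, §19]

## References
* [Markman2025SecantWeil] E. Markman, arXiv:2502.03415 (unrefereed), Thm 1.5.1.  [Pohlmann1968] Ann. of Math. 88, Thm 1.
  [Deligne1982HodgeCycles] LNM 900, §4 Prop. 4.4, §5 (c).  [MoonenZarhin1999LowDim] Math. Ann. 315, Thm. 0.1 (a).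
  [Shimura1998] §8.2, §8.4.  [MumfordAV1970] §19.  [Gordon1999HodgeAVSurvey] B. B. Gordon, 7.6.1, §9.2.
-/

noncomputable section

open CategoryTheory CategoryTheory.Limits NumberField

namespace Summit.HodgeConjecture.CorCM.DecicCurveFivefold

open Literature.AlgebraicGeometry Literature.AlgebraicGeometry.Motives Literature.AlgebraicGeometry.HodgeTheory
open Literature.AlgebraicGeometry.ComplexMultiplication (IsCMTypeRealisation)
open Summit.HodgeConjecture.CorCM.CyclicSextic (emb)


/-! ## §4 The intrinsic theorem: Galois decic CM field, half-circle type, modulo Markman's sixfold theorem -/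

section Main

variable {F : Type} [Field F] [NumberField F] [IsCMField F] [IsGalois ℚ F]
  {k : Type} [Field k] [NumberField k] [IsCMField k] {N : ℕ}
  {B : AbelianVariety ℂ} {Φ : CMType F} {ιB : 𝓞 F →+* End B} {θB : F →+* Module.End ℂ (complexBetti B.X 1)}
  {E : AbelianVariety ℂ} {Ψ : CMType k} {ιE : 𝓞 k →+* End E} {θE : k →+* Module.End ℂ (complexBetti E.X 1)}

omit [IsCMField k] in
/-- **The data of the main theorem exist for every Galois decic CM field receiving `k`** (non-vacuity of the
normalisation): a generator `σ` of `Gal(F/ℚ)` (`exists_generator_ten`) and a base embedding `p` with `p|_k = τ̄` (one of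
the five extensions of `τ̄`, `card_filter_comp_eq_five`). [cite: Dodson1984, §1.1] -/
theorem exists_generator_and_base (h10 : Module.finrank ℚ F = 10) (h2 : Module.finrank ℚ k = 2) (i : k →+* F)
    (τ : k →+* ℂ) : ∃ (σ : F ≃ₐ[ℚ] F) (p : F →+* ℂ), orderOf σ = 10 ∧ p.comp i = ComplexEmbedding.conjugate τ := by
  classical
  obtain ⟨σ, hσ, -⟩ := exists_generator_ten h10
  have hpos : 0 < (Finset.univ.filter fun s : F →+* ℂ => s.comp i = ComplexEmbedding.conjugate τ).card := by
    rw [card_filter_comp_eq_five i h10 h2]; norm_num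
  obtain ⟨p, hp⟩ := Finset.card_pos.1 hpos
  exact ⟨σ, p, hσ, (Finset.mem_filter.1 hp).2⟩

/-- **MAIN THEOREM (intrinsic form).  The Hodge conjecture for ALL PRODUCTS OF COPIES `B₀^a × E^c` of the half-circle CM
fivefold of a Galois (= cyclic) decic CM field and the CM curve of its imaginary quadratic subfield, GIVEN ONLY Markman's
hyperbolic-sixfold theorem.**  Data: `F` a Galois CM field with `[F:ℚ] = 10`, `σ` any generator of `Gal(F/ℚ)`
(`orderOf σ = 10`), `k` with `[k:ℚ] = 2`, `i : k → F`, `δ ∈ 𝓞_k` with `δ² = -d` (`d ≥ 1`) and `τ(δ) = i√d`, a base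
embedding `p : F → ℂ` with `p|_k = τ̄`; `B ⊨ (F; Φ)` with `Φ = {p ∘ σⁿ : n < 5}` (the HALF-CIRCLE type) and `E ⊨ (k; {τ})`.
Conclusion: for every slot map `κ : Fin N → Fin 2`, every rational `(q,q)`-class on `⨁_j ![B, E] (κ j)` — i.e. on
`B^a × E^c`, all `a, c`, any order — is algebraic.  (Frame `exists_cyclicFrame`; frame form
`hodgeConjectureFor_biproduct_comp_of_frame_of_markmanSixfold` at `Kf = (k, F)`.)  Displayed leaf:
`Markman2025_weilClasses_algebraic_hyperbolicSixfold` (UNREFEREED); nothing else.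
[cite: Markman2025SecantWeil, Thm 1.5.1] [cite: Pohlmann1968, Thm 1] [cite: Deligne1982HodgeCycles, §4 Prop. 4.4, §5 (c)]
[cite: MoonenZarhin1999LowDim, Thm. 0.1 (a)] [cite: Shimura1998, §8.4] -/
theorem hodgeConjectureFor_biproduct_comp_vec_of_halfCircle_of_markmanSixfold
    (hM : Markman2025_weilClasses_algebraic_hyperbolicSixfold)
    (h10 : Module.finrank ℚ F = 10) (h2 : Module.finrank ℚ k = 2) {σ : F ≃ₐ[ℚ] F} (hσ : orderOf σ = 10)
    (i : k →+* F) {δ : 𝓞 k} {d : ℕ} (hd : 0 < d) (hδ : ((δ : k)) ^ 2 = -(d : k)) {τ : k →+* ℂ}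
    (hτ : τ (δ : k) = Complex.I * (Real.sqrt d : ℂ)) {p : F →+* ℂ} (hp : p.comp i = ComplexEmbedding.conjugate τ)
    (hB : IsCMTypeRealisation Φ B ιB θB) (hΦ : ∀ s : F →+* ℂ, s ∈ Φ.1 ↔ ∃ n : ℕ, n < 5 ∧ s = emb σ p n)
    (hE : IsCMTypeRealisation Ψ E ιE θE) (hΨ : ∀ σ' : k →+* ℂ, σ' ∈ Ψ.1 ↔ σ' = τ) (κ : Fin N → Fin 2) :
    HodgeConjectureFor (⨁ fun j => (![B, E] : Fin 2 → AbelianVariety ℂ) (κ j)).dim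
      (⨁ fun j => (![B, E] : Fin 2 → AbelianVariety ℂ) (κ j)).X := by
  obtain ⟨e, he, he_sign, he_conj, he_gal⟩ := exists_cyclicFrame h10 h2 hσ p i hd hτ hp
  -- the half-circle type read in the frame
  have hΦ' : ∀ s : F →+* ℂ, s ∈ Φ.1 ↔ (e s).val < 5 := by
    intro s
    rw [hΦ]
    constructor
    · rintro ⟨n, hn, rfl⟩
      rw [he, ZMod.val_natCast, Nat.mod_eq_of_lt (by omega)]
      exact hn
    · intro hs
      refine ⟨(e s).val, hs, ?_⟩
      apply e.injective
      rw [he, ZMod.natCast_zmod_val]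
  -- the two-slot family `Kf = (k, F)`
  let Kf : Fin 2 → Type := Fin.cons k fun _ : Fin 1 => F
  letI instF : ∀ j, Field (Kf j) := fun j =>
    Fin.cases (motive := fun j => Field (Kf j)) ‹Field k› (fun _ => ‹Field F›) j
  letI instN : ∀ j, NumberField (Kf j) := fun j =>
    Fin.cases (motive := fun j => NumberField (Kf j)) ‹NumberField k› (fun _ => ‹NumberField F›) j
  haveI instC : ∀ j, IsCMField (Kf j) := fun j =>
    Fin.cases (motive := fun j => IsCMField (Kf j)) ‹IsCMField k› (fun _ => ‹IsCMField F›) j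
  exact hodgeConjectureFor_biproduct_comp_of_frame_of_markmanSixfold (Kf := Kf) (i₀ := 0) (i₁ := 1)
    (A₂ := ![B, E]) (Φ₂ := Fin.cons Φ (Fin.cons Ψ finZeroElim)) (ι₂ := Fin.cons ιB (Fin.cons ιE finZeroElim))
    (θ₂ := Fin.cons θB (Fin.cons θE finZeroElim)) hM κ h10 h2 i hd hδ hτ
    (Fin.cases hB (Fin.cases hE fun l => l.elim0)) e he_sign he_conj he_gal hΦ' hΨ

/-- **The Hodge conjecture for every abelian variety dominated by a product of copies of `B` and `E`** (intrinsic form,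
modulo Markman's sixfold theorem). [cite: Markman2025SecantWeil, Thm 1.5.1] [cite: MumfordAV1970, §19] -/
theorem hodgeConjectureFor_of_avDominatedBy_comp_vec_of_halfCircle_of_markmanSixfold
    (hM : Markman2025_weilClasses_algebraic_hyperbolicSixfold)
    (h10 : Module.finrank ℚ F = 10) (h2 : Module.finrank ℚ k = 2) {σ : F ≃ₐ[ℚ] F} (hσ : orderOf σ = 10)
    (i : k →+* F) {δ : 𝓞 k} {d : ℕ} (hd : 0 < d) (hδ : ((δ : k)) ^ 2 = -(d : k)) {τ : k →+* ℂ}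
    (hτ : τ (δ : k) = Complex.I * (Real.sqrt d : ℂ)) {p : F →+* ℂ} (hp : p.comp i = ComplexEmbedding.conjugate τ)
    (hB : IsCMTypeRealisation Φ B ιB θB) (hΦ : ∀ s : F →+* ℂ, s ∈ Φ.1 ↔ ∃ n : ℕ, n < 5 ∧ s = emb σ p n)
    (hE : IsCMTypeRealisation Ψ E ιE θE) (hΨ : ∀ σ' : k →+* ℂ, σ' ∈ Ψ.1 ↔ σ' = τ) (κ : Fin N → Fin 2)
    {X : AbelianVariety ℂ} (hX : Domination.AVDominatedBy X (⨁ fun j => (![B, E] : Fin 2 → AbelianVariety ℂ) (κ j))) :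
    HodgeConjectureFor X.dim X.X :=
  Domination.hodgeConjectureFor_of_avDominatedBy
    (hodgeConjectureFor_biproduct_comp_vec_of_halfCircle_of_markmanSixfold hM h10 h2 hσ i hd hδ hτ hp hB hΦ hE hΨ κ) hX

/-- **… for every abelian variety ISOGENOUS TO A PRODUCT OF COPIES of `B` and `E`** (any finite index type), modulo
Markman's sixfold theorem. [cite: Markman2025SecantWeil, Thm 1.5.1] [cite: MumfordAV1970, §19] -/
theorem hodgeConjectureFor_of_isIsogenous_biproduct_of_halfCircle_of_markmanSixfold
    (hM : Markman2025_weilClasses_algebraic_hyperbolicSixfold)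
    (h10 : Module.finrank ℚ F = 10) (h2 : Module.finrank ℚ k = 2) {σ : F ≃ₐ[ℚ] F} (hσ : orderOf σ = 10)
    (i : k →+* F) {δ : 𝓞 k} {d : ℕ} (hd : 0 < d) (hδ : ((δ : k)) ^ 2 = -(d : k)) {τ : k →+* ℂ}
    (hτ : τ (δ : k) = Complex.I * (Real.sqrt d : ℂ)) {p : F →+* ℂ} (hp : p.comp i = ComplexEmbedding.conjugate τ)
    (hB : IsCMTypeRealisation Φ B ιB θB) (hΦ : ∀ s : F →+* ℂ, s ∈ Φ.1 ↔ ∃ n : ℕ, n < 5 ∧ s = emb σ p n)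
    (hE : IsCMTypeRealisation Ψ E ιE θE) (hΨ : ∀ σ' : k →+* ℂ, σ' ∈ Ψ.1 ↔ σ' = τ)
    {J : Type} [Fintype J] (cls : J → Fin 2) {X : AbelianVariety ℂ}
    (hX : AbelianVariety.IsIsogenous X (⨁ fun j => (![B, E] : Fin 2 → AbelianVariety ℂ) (cls j))) :
    HodgeConjectureFor X.dim X.X := by
  classical
  let ε : Fin (Fintype.card J) ≃ J := (Fintype.equivFin J).symm
  have eJ : (⨁ fun j => (![B, E] : Fin 2 → AbelianVariety ℂ) (cls j)) ≅
      ⨁ fun l => (![B, E] : Fin 2 → AbelianVariety ℂ) (cls (ε l)) :=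
    (biproduct.reindex ε fun j => (![B, E] : Fin 2 → AbelianVariety ℂ) (cls j)).symm
  exact hodgeConjectureFor_of_avDominatedBy_comp_vec_of_halfCircle_of_markmanSixfold hM h10 h2 hσ i hd hδ hτ hp hB hΦ hE
    hΨ (fun l => cls (ε l)) (Domination.AVDominatedBy.of_isIsogenous hX ((Domination.AVDominatedBy.refl _).of_iso_right eJ))

/-- **… and for ALL POWERS of such an abelian variety** (`X ∼ ⨁_{j : J} ![B, E] (cls j)` ⟹ `HC(X^{M+1})` for every `M`),
modulo Markman's sixfold theorem. [cite: Markman2025SecantWeil, Thm 1.5.1] [cite: Gordon1999HodgeAVSurvey, 7.6.1] -/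
theorem hodgeConjectureFor_powSucc_of_isIsogenous_biproduct_of_halfCircle_of_markmanSixfold
    (hM : Markman2025_weilClasses_algebraic_hyperbolicSixfold)
    (h10 : Module.finrank ℚ F = 10) (h2 : Module.finrank ℚ k = 2) {σ : F ≃ₐ[ℚ] F} (hσ : orderOf σ = 10)
    (i : k →+* F) {δ : 𝓞 k} {d : ℕ} (hd : 0 < d) (hδ : ((δ : k)) ^ 2 = -(d : k)) {τ : k →+* ℂ}
    (hτ : τ (δ : k) = Complex.I * (Real.sqrt d : ℂ)) {p : F →+* ℂ} (hp : p.comp i = ComplexEmbedding.conjugate τ)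
    (hB : IsCMTypeRealisation Φ B ιB θB) (hΦ : ∀ s : F →+* ℂ, s ∈ Φ.1 ↔ ∃ n : ℕ, n < 5 ∧ s = emb σ p n)
    (hE : IsCMTypeRealisation Ψ E ιE θE) (hΨ : ∀ σ' : k →+* ℂ, σ' ∈ Ψ.1 ↔ σ' = τ)
    {J : Type} [Fintype J] (cls : J → Fin 2) {X : AbelianVariety ℂ}
    (hX : AbelianVariety.IsIsogenous X (⨁ fun j => (![B, E] : Fin 2 → AbelianVariety ℂ) (cls j))) (M : ℕ) :
    HodgeConjectureFor (X.powSucc M).dim (X.powSucc M).X := by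
  obtain ⟨n, ρ, hdom⟩ := exists_avDominatedBy_powSucc_biproduct_slots_of_isIsogenous hX M
  exact hodgeConjectureFor_of_avDominatedBy_comp_vec_of_halfCircle_of_markmanSixfold hM h10 h2 hσ i hd hδ hτ hp hB hΦ hE
    hΨ ρ hdom

/-- **The literal sixfold `B × E` and its factors**: in particular the Hodge conjecture for `B × E`, `B` and `E` themselves
(slot maps `id`, `![0]`, `![1]`; `(A₀ × A₁) ≅ ⨁_{j<2} A_j`, `PairWeights.hodgeConjectureFor_prod_of_biproduct`), modulo
Markman's sixfold theorem. [cite: Markman2025SecantWeil, Thm 1.5.1] [cite: MoonenZarhin1999LowDim, Thm. 0.1 (a)] -/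
theorem hodgeConjectureFor_prod_of_halfCircle_of_markmanSixfold
    (hM : Markman2025_weilClasses_algebraic_hyperbolicSixfold)
    (h10 : Module.finrank ℚ F = 10) (h2 : Module.finrank ℚ k = 2) {σ : F ≃ₐ[ℚ] F} (hσ : orderOf σ = 10)
    (i : k →+* F) {δ : 𝓞 k} {d : ℕ} (hd : 0 < d) (hδ : ((δ : k)) ^ 2 = -(d : k)) {τ : k →+* ℂ}
    (hτ : τ (δ : k) = Complex.I * (Real.sqrt d : ℂ)) {p : F →+* ℂ} (hp : p.comp i = ComplexEmbedding.conjugate τ)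
    (hB : IsCMTypeRealisation Φ B ιB θB) (hΦ : ∀ s : F →+* ℂ, s ∈ Φ.1 ↔ ∃ n : ℕ, n < 5 ∧ s = emb σ p n)
    (hE : IsCMTypeRealisation Ψ E ιE θE) (hΨ : ∀ σ' : k →+* ℂ, σ' ∈ Ψ.1 ↔ σ' = τ) :
    HodgeConjectureFor (B.prod E).dim (B.prod E).X := by
  have h := hodgeConjectureFor_biproduct_comp_vec_of_halfCircle_of_markmanSixfold hM h10 h2 hσ i hd hδ hτ hp hB hΦ hE hΨ id
  exact PairWeights.hodgeConjectureFor_prod_of_biproduct (A := ![B, E]) h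

end Main

end Summit.HodgeConjecture.CorCM.DecicCurveFivefold

end
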